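import Literature.Computability.Complexity.ParallelRepetitionProduct
import HarnessLib
/-!
# Parallel repetition, II: the approximation bound for expanding projection games (Dinur–Steurer, Thm. 3.4)

Topic `Computability/Complexity`, namespace `Literature.Computability.Complexity.ProjGame`.
Dinur–Steurer, *Analytical approach to parallel repetition* (STOC 2014; arXiv:1305.1979), §3.2,
PROVED: for a `γ`-expanding projection game the relaxation `λ₊` is close to the value, so that —
with Theorem 3.2 (`ParallelRepetitionProduct.lean`) — the value of `G^{⊗k}` decays exponentially.

* `symForm g = ⟨g, A g⟩ = 𝔼_u (𝔼_{(v,π)|u} g(v))²` — the quadratic form of the random walk `A` on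
  the symmetrized game `G_sym` (§2.4), `normVE g = 𝔼_v g(v)²`, `meanE g = 𝔼_v g(v)`;
  `Spectral γ` — "`γ`-expanding" in the form used in the proof of Thm. 3.4:
  `⟨g, A g⟩ ≤ (1-γ)‖g‖² + γ ḡ²`, i.e. `⟨g, L g⟩ ≥ γ ‖g - ḡ‖²` for `L = Id - A` (p. 12: "the second
  smallest eigenvalue [of `L`] is at least `γ`").
* `det ℓ g` — DETERMINISTIC fractional assignments (`f(v, β) = 0` unless `β = ℓ v`); `exists_det`
  — the derandomisation step of the proof ("we may assume that `f` is deterministic": replacing a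
  row by a vertex of the simplex does not decrease the convex function `f ↦ ‖G f‖²`).
* `defect_le` — the chain of inequalities concluding the printed proof
  (`1 - ‖G‖² ≤ 𝔼 (1 - Q_{vv'}) ≤ 36 ε/γ + 18 ε`, here with the pointwise inequality
  `1 ≤ 9ab + 9(a - ḡ)² + 9(b - ḡ)²` for `ḡ ≥ 2/3`).
* **Theorem 3.4, contrapositive and supremum-free** (`lamLe_of_spectral`): if `G` is
  `γ`-expanding and `val(G) ≤ 1 - η`, then `‖G h‖² ≤ (1 - ε) ‖T h‖²` for every `h ≥ 0`, with
  `ε = dsEps γ η = min (γ/3) (η γ / (18 + 9 γ))` (printed: "Suppose `λ₊(G) > 1 - ε`. Then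
  `‖G‖ > 1 - O(ε/γ)`"; the constants here come from normalising `‖T h‖ = 1` linearly rather than
  quadratically and are immaterial downstream).

## References

* I. Dinur, D. Steurer, *Analytical approach to parallel repetition*, Proc. 46th STOC (2014)
  624–633; arXiv:1305.1979: §2.4 (expanding games), §2.5, Def. 3.1, Thm. 3.4 and its proof (§3.2).
-/

namespace Literature.Computability.Complexity

open Finset

namespace ProjGame

variable {E V U β α : Type} [Fintype E] [Fintype V] [Fintype U] [Fintype β] [Fintype α]
  [DecidableEq V] [DecidableEq U] [DecidableEq β] [DecidableEq α]
  (G : ProjGame E V U β α)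

/-! ### Deterministic fractional assignments -/

section Det

/-- The deterministic fractional assignment with labels `ℓ` and magnitudes `g`:
`f(v, β) = g(v)` if `β = ℓ v`, else `0` ("for every vertex `v` there is at most one label `β` such
that `f(v, β) > 0`"). [cite: DinurSteurer2014, Thm. 3.4 (proof)] -/
def det (ℓ : V → β) (g : V → ℝ) : V → β → ℝ := fun v b => if b = ℓ v then g v else 0

omit [Fintype V] [DecidableEq V] in
/-- Row sums of a deterministic assignment. [folklore] -/
theorem sum_det (ℓ : V → β) (g : V → ℝ) (v : V) : ∑ b, det ℓ g v b = g v := by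
  unfold det
  rw [sum_ite_eq' univ (ℓ v) (fun _ => g v), if_pos (mem_univ _)]

omit [Fintype V] [Fintype β] [DecidableEq V] in
/-- A deterministic assignment with nonnegative magnitudes is nonnegative. [folklore] -/
theorem det_nonneg (ℓ : V → β) {g : V → ℝ} (hg : ∀ v, 0 ≤ g v) : Nonneg (det ℓ g) := fun v b => by
  unfold det; split_ifs; exacts [hg v, le_rfl]

omit [Fintype V] [Fintype β] [DecidableEq V] in
/-- Scaling the magnitudes scales the assignment. [folklore] -/
theorem det_smul (ℓ : V → β) (c : ℝ) (g : V → ℝ) : det ℓ (c • g) = c • det ℓ g := by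
  funext v b
  simp only [det, Pi.smul_apply, smul_eq_mul]
  split_ifs <;> simp

omit [Fintype V] [Fintype β] [DecidableEq V] in
/-- The indicator assignment is the deterministic assignment with unit magnitudes. [folklore] -/
theorem indic_eq_det (ℓ : V → β) : indic ℓ = det ℓ (fun _ => (1 : ℝ)) := rfl

omit [Fintype E] [Fintype V] [Fintype U] [Fintype α] [DecidableEq V] [DecidableEq U] in
/-- `lift` of a deterministic assignment. [folklore] -/
theorem lift_det (ℓ : V → β) (g : V → ℝ) (e : E) (a : α) :
    G.lift (det ℓ g) e a = if G.proj e (ℓ (G.src e)) = some a then g (G.src e) else 0 := by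
  unfold lift det
  rw [← sum_filter, sum_ite_eq' (univ.filter fun b' => G.proj e b' = some a) (ℓ (G.src e)) (fun _ => g (G.src e))]
  simp only [mem_filter, mem_univ, true_and]

omit [Fintype U] [Fintype α] [DecidableEq U] [DecidableEq α] in
/-- `‖T (det ℓ g)‖² = 𝔼_v g(v)²` (vertex form). [cite: DinurSteurer2014, §2.5] -/
theorem normT_det (ℓ : V → β) (g : V → ℝ) : G.normT (det ℓ g) = ∑ v, G.wV v / G.total * g v ^ 2 := by
  unfold normT
  simp_rw [sum_det]

end Det

/-! ### Scaling -/

section Smul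

omit [Fintype V] [DecidableEq V] [DecidableEq β] in
/-- `‖G (c f)‖² = c² ‖G f‖²`. [folklore] -/
theorem normG_smul (c : ℝ) (f : V → β → ℝ) : G.normG (c • f) = c ^ 2 * G.normG f := by
  unfold normG
  rw [mul_sum]
  refine sum_congr rfl fun u _ => ?_
  rw [mul_sum, mul_sum, mul_sum]
  refine sum_congr rfl fun a _ => ?_
  rw [app_smul]
  ring

omit [Fintype U] [Fintype α] [DecidableEq U] [DecidableEq β] [DecidableEq α] in
/-- `‖T (c f)‖² = c² ‖T f‖²`. [folklore] -/
theorem normT_smul (c : ℝ) (f : V → β → ℝ) : G.normT (c • f) = c ^ 2 * G.normT f := by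
  unfold normT
  rw [mul_sum]
  refine sum_congr rfl fun v _ => ?_
  simp only [Pi.smul_apply, smul_eq_mul, ← mul_sum]
  ring

end Smul

/-! ### Edge forms: `𝔼_v` as a weighted sum over edges -/

section EdgeForms

omit [Fintype U] [Fintype β] [Fintype α] [DecidableEq U] [DecidableEq β] [DecidableEq α] in
/-- `∑_v wV v · φ v = ∑_e w_e φ(src e)` (the measure `μ_V` is the `src`-marginal of the edge
distribution). [cite: DinurSteurer2014, §2.1] -/
theorem sum_wV_mul (φ : V → ℝ) : ∑ v, G.wV v * φ v = ∑ e, G.wt e * φ (G.src e) := by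
  unfold wV
  simp_rw [sum_mul]
  rw [sum_comm]
  refine sum_congr rfl fun e _ => ?_
  simp_rw [ite_zero_mul]
  rw [sum_ite_eq univ (G.src e), if_pos (mem_univ _)]

omit [Fintype V] [Fintype β] [Fintype α] [DecidableEq V] [DecidableEq β] [DecidableEq α] in
/-- `∑_u ∑_{e : dst e = u} F e = ∑_e F e`. [folklore] -/
theorem sum_fiber_dst (F : E → ℝ) : ∑ u, ∑ e, (if G.dst e = u then F e else 0) = ∑ e, F e := by
  rw [sum_comm]
  exact sum_congr rfl fun e _ => by rw [sum_ite_eq univ (G.dst e), if_pos (mem_univ _)]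

/-- `‖g‖² = 𝔼_v g(v)² = (∑_e w_e g(src e)²) / total`. [cite: DinurSteurer2014, §2.1] -/
noncomputable def normVE (g : V → ℝ) : ℝ := (∑ e, G.wt e * g (G.src e) ^ 2) / G.total

/-- `ḡ = 𝔼_v g(v) = (∑_e w_e g(src e)) / total`. [cite: DinurSteurer2014, Thm. 3.4 (proof, `f̄`)] -/
noncomputable def meanE (g : V → ℝ) : ℝ := (∑ e, G.wt e * g (G.src e)) / G.total

omit [Fintype U] [Fintype β] [Fintype α] [DecidableEq U] [DecidableEq β] [DecidableEq α] in
/-- Vertex form of `normVE`. [folklore] -/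
theorem normVE_eq (g : V → ℝ) : G.normVE g = ∑ v, G.wV v / G.total * g v ^ 2 := by
  unfold normVE
  rw [← G.sum_wV_mul (fun v => g v ^ 2), sum_div]
  exact sum_congr rfl fun v _ => by ring

omit [Fintype U] [Fintype α] [DecidableEq U] [DecidableEq α] in
/-- `‖T (det ℓ g)‖² = ‖g‖²`. [cite: DinurSteurer2014, §2.5] -/
theorem normT_det_eq_normVE (ℓ : V → β) (g : V → ℝ) : G.normT (det ℓ g) = G.normVE g := by
  rw [normT_det, normVE_eq]

omit [Fintype V] [Fintype U] [Fintype β] [Fintype α] [DecidableEq V] [DecidableEq U] [DecidableEq β] [DecidableEq α] in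
/-- The variance identity `𝔼 (g - ḡ)² = 𝔼 g² - ḡ²`. [folklore] -/
theorem normVE_sub_meanE [Nonempty E] (g : V → ℝ) :
    G.normVE (fun v => g v - G.meanE g) = G.normVE g - G.meanE g ^ 2 := by
  have hW := G.total_pos.ne'
  have hS : ∑ e, G.wt e * g (G.src e) = G.meanE g * G.total := by
    unfold meanE; field_simp
  have hnum : ∑ e, G.wt e * (g (G.src e) - G.meanE g) ^ 2 =
      (∑ e, G.wt e * g (G.src e) ^ 2) - G.meanE g ^ 2 * G.total := by
    have h : ∀ e, G.wt e * (g (G.src e) - G.meanE g) ^ 2 =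
        G.wt e * g (G.src e) ^ 2 - 2 * G.meanE g * (G.wt e * g (G.src e)) + G.meanE g ^ 2 * G.wt e := fun e => by ring
    simp_rw [h]
    rw [sum_add_distrib, sum_sub_distrib, ← mul_sum, ← mul_sum, hS, show (∑ e, G.wt e) = G.total from rfl]
    ring
  unfold normVE
  rw [hnum, sub_div, mul_div_assoc, div_self hW, mul_one]

omit [Fintype V] [Fintype U] [Fintype β] [Fintype α] [DecidableEq V] [DecidableEq U] [DecidableEq β] [DecidableEq α] in
/-- `ḡ ≥ 0` for `g ≥ 0`. [folklore] -/
theorem meanE_nonneg {g : V → ℝ} (hg : ∀ v, 0 ≤ g v) : 0 ≤ G.meanE g :=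
  div_nonneg (sum_nonneg fun e _ => mul_nonneg (G.wt_nonneg e) (hg _)) G.total_nonneg

omit [Fintype V] [Fintype U] [Fintype β] [Fintype α] [DecidableEq V] [DecidableEq U] [DecidableEq β] [DecidableEq α] in
/-- `𝔼 g² ≥ 0`. [folklore] -/
theorem normVE_nonneg (g : V → ℝ) : 0 ≤ G.normVE g :=
  div_nonneg (sum_nonneg fun e _ => mul_nonneg (G.wt_nonneg e) (sq_nonneg _)) G.total_nonneg

end EdgeForms

/-! ### Pair sums at a vertex of Alice, the symmetrized form, expansion -/

section PairSums

/-- `pS u F = ∑_{e, e' : dst e = dst e' = u} w_e w_{e'} F(e, e')`: two independent edges at `u`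
(unnormalised), the building block of the symmetrized game `G_sym` (Def. 2.5).
[cite: DinurSteurer2014, Def. 2.5] -/
def pS (u : U) (F : E → E → ℝ) : ℝ :=
  ∑ e, ∑ e', if G.dst e = u then (if G.dst e' = u then G.wt e * G.wt e' * F e e' else 0) else 0

omit [Fintype V] [Fintype U] [Fintype β] [Fintype α] [DecidableEq V] [DecidableEq β] [DecidableEq α] in
/-- `pS` is additive in `F`. [folklore] -/
theorem pS_add (u : U) (F F' : E → E → ℝ) : G.pS u (fun e e' => F e e' + F' e e') = G.pS u F + G.pS u F' := by
  unfold pS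
  rw [← sum_add_distrib]
  refine sum_congr rfl fun e _ => ?_
  rw [← sum_add_distrib]
  refine sum_congr rfl fun e' _ => ?_
  split_ifs <;> ring

omit [Fintype V] [Fintype U] [Fintype β] [Fintype α] [DecidableEq V] [DecidableEq β] [DecidableEq α] in
/-- `pS` is homogeneous in `F`. [folklore] -/
theorem pS_const_mul (u : U) (c : ℝ) (F : E → E → ℝ) : G.pS u (fun e e' => c * F e e') = c * G.pS u F := by
  unfold pS
  rw [mul_sum]
  refine sum_congr rfl fun e _ => ?_
  rw [mul_sum]
  refine sum_congr rfl fun e' _ => ?_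
  split_ifs <;> ring

omit [Fintype V] [Fintype U] [Fintype β] [Fintype α] [DecidableEq V] [DecidableEq β] [DecidableEq α] in
/-- `pS` is subtractive in `F`. [folklore] -/
theorem pS_sub (u : U) (F F' : E → E → ℝ) : G.pS u (fun e e' => F e e' - F' e e') = G.pS u F - G.pS u F' := by
  unfold pS
  rw [← sum_sub_distrib]
  refine sum_congr rfl fun e _ => ?_
  rw [← sum_sub_distrib]
  refine sum_congr rfl fun e' _ => ?_
  split_ifs <;> ring

omit [Fintype V] [Fintype U] [Fintype β] [Fintype α] [DecidableEq V] [DecidableEq β] [DecidableEq α] in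
/-- `pS` is monotone in `F` on the edges at `u`. [folklore] -/
theorem pS_mono (u : U) {F F' : E → E → ℝ} (h : ∀ e e', G.dst e = u → G.dst e' = u → F e e' ≤ F' e e') :
    G.pS u F ≤ G.pS u F' := by
  unfold pS
  refine sum_le_sum fun e _ => sum_le_sum fun e' _ => ?_
  split_ifs with h1 h2
  · exact mul_le_mul_of_nonneg_left (h e e' h1 h2) (mul_nonneg (G.wt_nonneg e) (G.wt_nonneg e'))
  · exact le_rfl
  · exact le_rfl

omit [Fintype V] [Fintype U] [Fintype β] [Fintype α] [DecidableEq V] [DecidableEq β] [DecidableEq α] in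
/-- `pS` of a function of the first edge only: `(∑_{e : dst e = u} w_e φ e) · wU u`. [folklore] -/
theorem pS_left (u : U) (φ : E → ℝ) :
    G.pS u (fun e _ => φ e) = (∑ e, if G.dst e = u then G.wt e * φ e else 0) * G.wU u := by
  unfold pS wU
  rw [sum_mul]
  refine sum_congr rfl fun e _ => ?_
  rw [ite_zero_mul, mul_sum]
  by_cases he : G.dst e = u
  · simp only [he, if_true]
    refine sum_congr rfl fun e' _ => ?_
    split_ifs <;> ring
  · simp only [he, if_false, sum_const_zero]

omit [Fintype V] [Fintype U] [Fintype β] [Fintype α] [DecidableEq V] [DecidableEq β] [DecidableEq α] in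
/-- `pS` of a function of the second edge only: `(∑_{e' : dst e' = u} w_{e'} φ e') · wU u`. [folklore] -/
theorem pS_right (u : U) (φ : E → ℝ) :
    G.pS u (fun _ e' => φ e') = (∑ e, if G.dst e = u then G.wt e * φ e else 0) * G.wU u := by
  unfold pS wU
  rw [sum_comm, sum_mul]
  refine sum_congr rfl fun e' _ => ?_
  rw [ite_zero_mul, mul_sum]
  by_cases he : G.dst e' = u
  · simp only [he, if_true]
    refine sum_congr rfl fun e _ => ?_
    split_ifs <;> ring
  · simp only [he, if_false]
    refine sum_eq_zero fun e _ => ?_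
    split_ifs <;> rfl

omit [Fintype V] [Fintype U] [Fintype β] [Fintype α] [DecidableEq V] [DecidableEq β] [DecidableEq α] in
/-- Squaring a weighted sum over the edges at `u`: `(∑_{e : dst e = u} w_e x_e)² = pS u (x ⊗ x)`. [folklore] -/
theorem sq_fiber_sum (u : U) (x : E → ℝ) :
    (∑ e, if G.dst e = u then G.wt e * x e else 0) ^ 2 = G.pS u (fun e e' => x e * x e') := by
  unfold pS
  rw [sq, sum_mul_sum]
  refine sum_congr rfl fun e _ => sum_congr rfl fun e' _ => ?_
  split_ifs <;> ring

omit [Fintype V] [Fintype U] [Fintype β] [DecidableEq V] [DecidableEq β] in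
/-- The collision sum: `∑_α (∑_{e : dst e = u} w_e [p e = α] x_e)² = pS u (x ⊗ x · C)` with the
collision indicator `C(e, e') = [p e = p e' ≠ none]` ("`β, β'` collide", §2.3). [cite: DinurSteurer2014, §2.3] -/
theorem sum_sq_fiber_proj (u : U) (x : E → ℝ) (p : E → Option α) :
    ∑ a, (∑ e, if G.dst e = u then G.wt e * (if p e = some a then x e else 0) else 0) ^ 2 =
      G.pS u (fun e e' => x e * x e' * if p e = p e' ∧ (p e).isSome then 1 else 0) := by
  simp_rw [sq_fiber_sum]
  unfold pS
  rw [sum_comm]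
  refine sum_congr rfl fun e _ => ?_
  rw [sum_comm]
  refine sum_congr rfl fun e' _ => ?_
  by_cases he : G.dst e = u
  · by_cases he' : G.dst e' = u
    · simp only [he, he', if_true]
      rw [← mul_sum]
      congr 1
      cases hpe : p e with
      | none =>
        simp
      | some a₀ =>
        simp only [Option.some.injEq, Option.isSome_some, and_true]
        rw [show (∑ a, (if a₀ = a then x e else 0) * (if p e' = some a then x e' else 0)) =
            (if p e' = some a₀ then x e * x e' else 0) from by
          rw [Finset.sum_eq_single a₀ (fun a _ ha => by rw [if_neg (Ne.symm ha), zero_mul]) (fun h => absurd (mem_univ _) h)]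
          simp only [if_true]
          split_ifs <;> ring]
        by_cases h' : p e' = some a₀
        · rw [if_pos h', if_pos h'.symm, mul_one]
        · rw [if_neg h', if_neg (fun h => h' h.symm), mul_zero]
    · simp [he, he']
  · simp [he]

/-- **The quadratic form of the symmetrized random walk**, `⟨g, A g⟩ = 𝔼_u (𝔼_{(v,π)|u} g(v))²`
(Dinur–Steurer §2.4: `A_{v₁,v₂} = μ_sym(v₂ | v₁)`; here through its closed form as a sum over
Alice's vertices). [cite: DinurSteurer2014, §2.4] -/
noncomputable def symForm (g : V → ℝ) : ℝ :=
  ∑ u, (∑ e, if G.dst e = u then G.wt e * g (G.src e) else 0) ^ 2 / (G.total * G.wU u)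

omit [Fintype V] [Fintype β] [Fintype α] [DecidableEq V] [DecidableEq β] [DecidableEq α] in
/-- `⟨g, A g⟩` as pair sums. [cite: DinurSteurer2014, §2.4] -/
theorem symForm_eq_pS (g : V → ℝ) :
    G.symForm g = ∑ u, G.pS u (fun e e' => g (G.src e) * g (G.src e')) / (G.total * G.wU u) := by
  unfold symForm
  simp_rw [sq_fiber_sum]

omit [Fintype V] [Fintype β] [Fintype α] [DecidableEq V] [DecidableEq β] [DecidableEq α] in
/-- `⟨g, A g⟩ ≤ ‖g‖²` (Cauchy–Schwarz at every vertex of Alice; `A` is a Markov operator). [cite: DinurSteurer2014, §2.4] -/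
theorem symForm_le_normVE [Nonempty E] (g : V → ℝ) : G.symForm g ≤ G.normVE g := by
  unfold symForm normVE
  rw [← G.sum_fiber_dst (fun e => G.wt e * g (G.src e) ^ 2), sum_div]
  refine sum_le_sum fun u _ => ?_
  have hwU := G.wU_pos u
  have hcs := sq_sum_mul_le_mul_sum_mul_sq univ
    (μ := fun e => if G.dst e = u then G.wt e else 0) (fun e _ => by split_ifs; exacts [G.wt_nonneg e, le_rfl])
    (fun e => g (G.src e))
  have h1 : (∑ e, (if G.dst e = u then G.wt e else 0) * g (G.src e)) =
      ∑ e, (if G.dst e = u then G.wt e * g (G.src e) else 0) :=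
    sum_congr rfl fun e _ => by rw [ite_zero_mul]
  have h2 : (∑ e, (if G.dst e = u then G.wt e else 0) * g (G.src e) ^ 2) =
      ∑ e, (if G.dst e = u then G.wt e * g (G.src e) ^ 2 else 0) :=
    sum_congr rfl fun e _ => by rw [ite_zero_mul]
  rw [h1, h2] at hcs
  change (∑ e, if G.dst e = u then G.wt e * g (G.src e) else 0) ^ 2 ≤ G.wU u * _ at hcs
  have key : (∑ e, if G.dst e = u then G.wt e * g (G.src e) else 0) ^ 2 / G.wU u ≤
      ∑ e, if G.dst e = u then G.wt e * g (G.src e) ^ 2 else 0 := (div_le_iff₀' hwU).2 hcs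
  rw [mul_comm G.total, ← div_div]
  exact div_le_div_of_nonneg_right key G.total_nonneg

/-- **`γ`-expanding games**, in the form used in the proof of Thm. 3.4: `⟨g, A g⟩ ≤ (1-γ) ‖g‖² + γ ḡ²`
for every `g`, i.e. `⟨g, L g⟩ ≥ γ ‖g^⊥‖²` with `L = Id - A`, `g^⊥ = g - ḡ` (Dinur–Steurer §2.4:
"`G` is said to be `c`-expanding if the spectral gap of the Markov chain `A` corresponding to `G_sym`
is at least `c`"; the spectral gap bounds exactly this Rayleigh quotient). [cite: DinurSteurer2014, §2.4 and Thm. 3.4 (proof)] -/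
def Spectral (γ : ℝ) : Prop := ∀ g : V → ℝ, G.symForm g ≤ (1 - γ) * G.normVE g + γ * G.meanE g ^ 2

omit [Fintype V] [DecidableEq V] in
/-- `‖G (det ℓ g)‖²` as pair sums with the collision indicator. [cite: DinurSteurer2014, Thm. 3.4 (proof, Eq. "1-have")] -/
theorem normG_det_eq_pS [Nonempty E] (ℓ : V → β) (g : V → ℝ) :
    G.normG (det ℓ g) = ∑ u, G.pS u (fun e e' => g (G.src e) * g (G.src e') *
      if G.proj e (ℓ (G.src e)) = G.proj e' (ℓ (G.src e')) ∧ (G.proj e (ℓ (G.src e))).isSome then 1 else 0) /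
        (G.total * G.wU u) := by
  unfold normG
  refine sum_congr rfl fun u _ => ?_
  have hwU := (G.wU_pos u).ne'
  have hW := G.total_pos.ne'
  rw [← G.sum_sq_fiber_proj u (fun e => g (G.src e)) (fun e => G.proj e (ℓ (G.src e))), mul_sum, sum_div]
  refine sum_congr rfl fun a _ => ?_
  rw [app_eq_appW_div, appW_eq]
  simp_rw [← G.lift_det ℓ g]
  unfold lift
  field_simp

/-- The **defect** of a labelling `ℓ`: the `μ_sym`-probability that the two labels do NOT collide,
`𝔼_{(v,v')} (1 - Q_{v,v'}) = 1 - ‖G 1_ℓ‖²`. [cite: DinurSteurer2014, Thm. 3.4 (proof, Eq. "2-want")] -/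
noncomputable def defect (ℓ : V → β) : ℝ :=
  ∑ u, G.pS u (fun e e' => 1 - if G.proj e (ℓ (G.src e)) = G.proj e' (ℓ (G.src e')) ∧
    (G.proj e (ℓ (G.src e))).isSome then 1 else 0) / (G.total * G.wU u)

omit [Fintype V] [Fintype β] [Fintype α] [DecidableEq V] [DecidableEq β] [DecidableEq α] in
/-- `∑_u pS u 1 / (total · wU u) = 1`. [folklore] -/
theorem sum_pS_one [Nonempty E] : ∑ u, G.pS u (fun _ _ => (1 : ℝ)) / (G.total * G.wU u) = 1 := by
  have h : ∀ u, G.pS u (fun _ _ => (1 : ℝ)) / (G.total * G.wU u) = G.wU u / G.total := fun u => by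
    rw [G.pS_left u (fun _ => 1)]
    have h1 : (∑ e, if G.dst e = u then G.wt e * 1 else 0) = G.wU u := by
      unfold wU; exact sum_congr rfl fun e _ => by rw [mul_one]
    rw [h1]
    have := (G.wU_pos u).ne'
    field_simp
  simp_rw [h]
  exact G.sum_wU_div_total

omit [Fintype V] [DecidableEq V] in
/-- `defect ℓ + ‖G 1_ℓ‖² = 1` (collision and non-collision probabilities). [cite: DinurSteurer2014, Thm. 3.4 (proof)] -/
theorem defect_add_normG_indic [Nonempty E] (ℓ : V → β) : G.defect ℓ + G.normG (indic ℓ) = 1 := by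
  rw [indic_eq_det, normG_det_eq_pS]
  unfold defect
  rw [← sum_add_distrib]
  refine Eq.trans ?_ G.sum_pS_one
  refine sum_congr rfl fun u _ => ?_
  rw [← add_div, ← pS_add]
  congr 1
  unfold pS
  refine sum_congr rfl fun e _ => sum_congr rfl fun e' _ => ?_
  split_ifs <;> ring

omit [Fintype V] [DecidableEq V] in
/-- `defect ℓ = 1 - ‖G 1_ℓ‖²`. [cite: DinurSteurer2014, Thm. 3.4 (proof)] -/
theorem defect_eq [Nonempty E] (ℓ : V → β) : G.defect ℓ = 1 - G.normG (indic ℓ) := by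
  have := G.defect_add_normG_indic ℓ
  linarith

/-- **The defect is at least `η` when `val(G) ≤ 1 - η`** (Claim 2.3: `‖G 1_ℓ‖² ≤ val(G_sym) … ≤ val(G)`).
[cite: DinurSteurer2014, Thm. 3.4 (proof, Eq. "2-want") and Claim 2.3] -/
theorem le_defect [Nonempty E] {η : ℝ} (hη1 : η ≤ 1) (hval : G.ValLe (1 - η)) (ℓ : V → β) :
    η ≤ G.defect ℓ := by
  rw [defect_eq]
  have := G.normG_le_of_valLe (by linarith) hval (indic_nonneg ℓ) (fun v => (sum_indic ℓ v).le)
  linarith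

/-- The elementary inequality of the proof of Thm. 3.4: for `a, b ≥ 0` and `m ≥ 2/3`,
`1 ≤ 9ab + 9(a - m)² + 9(b - m)²` ("if one of `a` or `b` is smaller than `1/3`, then one of the last
two terms contributes at least `1` …; if both are at least `1/3`, then the first term contributes
at least `1`"). [cite: DinurSteurer2014, Thm. 3.4 (proof)] -/
theorem one_le_nine (a b m : ℝ) (ha : 0 ≤ a) (hb : 0 ≤ b) (hm : 2 / 3 ≤ m) :
    1 ≤ 9 * (a * b) + 9 * (a - m) ^ 2 + 9 * (b - m) ^ 2 := by
  rcases le_or_gt a (1 / 3) with ha' | ha'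
  · nlinarith [sq_nonneg (b - m), mul_nonneg ha hb]
  rcases le_or_gt b (1 / 3) with hb' | hb'
  · nlinarith [sq_nonneg (a - m), mul_nonneg ha hb]
  · nlinarith [sq_nonneg (a - m), sq_nonneg (b - m)]

omit [Fintype V] [DecidableEq V] in
/-- **The chain of inequalities concluding the proof of Thm. 3.4**: for a labelling `ℓ` and
magnitudes `g ≥ 0` with `ḡ ≥ 2/3`,
`defect ℓ ≤ 9 (⟨g, A g⟩ - ‖G (det ℓ g)‖²) + 18 · 𝔼 (g - ḡ)²`
(printed: `1 - ‖G‖² ≤ 𝔼 (1 - Q) · 9((f_v - f̄)² + (f_{v'} - f̄)² + f_v f_{v'}) ≤ 36ε/γ + 18ε`).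
[cite: DinurSteurer2014, Thm. 3.4 (proof)] -/
theorem defect_le [Nonempty E] (ℓ : V → β) {g : V → ℝ} (hg : ∀ v, 0 ≤ g v) (hm : 2 / 3 ≤ G.meanE g) :
    G.defect ℓ ≤ 9 * (G.symForm g - G.normG (det ℓ g)) + 18 * G.normVE (fun v => g v - G.meanE g) := by
  set m := G.meanE g with hm_def
  -- abbreviations for the integrands
  set C : E → E → ℝ := fun e e' => if G.proj e (ℓ (G.src e)) = G.proj e' (ℓ (G.src e')) ∧
    (G.proj e (ℓ (G.src e))).isSome then 1 else 0 with hC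
  have hC01 : ∀ e e', C e e' = 0 ∨ C e e' = 1 := fun e e' => by
    simp only [hC]; split_ifs; exacts [Or.inr rfl, Or.inl rfl]
  -- pointwise inequality
  have hpt : ∀ e e', (1 - C e e') ≤ 9 * (g (G.src e) * g (G.src e') * (1 - C e e')) +
      9 * (g (G.src e) - m) ^ 2 + 9 * (g (G.src e') - m) ^ 2 := fun e e' => by
    have h9 := one_le_nine (g (G.src e)) (g (G.src e')) m (hg _) (hg _) hm
    rcases hC01 e e' with h0 | h1
    · rw [h0]; linarith
    · rw [h1]; nlinarith [sq_nonneg (g (G.src e) - m), sq_nonneg (g (G.src e') - m)]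
  -- sum it with `pS`
  have hsum : ∀ u, G.pS u (fun e e' => 1 - C e e') ≤
      9 * (G.pS u (fun e e' => g (G.src e) * g (G.src e')) - G.pS u (fun e e' => g (G.src e) * g (G.src e') * C e e')) +
      9 * G.pS u (fun e _ => (g (G.src e) - m) ^ 2) + 9 * G.pS u (fun _ e' => (g (G.src e') - m) ^ 2) := fun u => by
    rw [← pS_sub, ← pS_const_mul, ← pS_const_mul, ← pS_const_mul, ← pS_add, ← pS_add]
    refine G.pS_mono u fun e e' _ _ => ?_
    have h1 := hpt e e'
    have h2 : 9 * (g (G.src e) * g (G.src e') * (1 - C e e')) =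
        9 * (g (G.src e) * g (G.src e') - g (G.src e) * g (G.src e') * C e e') := by ring
    linarith
  -- divide by `total · wU u` and sum over `u`
  have hdiv : ∀ u, G.pS u (fun e e' => 1 - C e e') / (G.total * G.wU u) ≤
      9 * (G.pS u (fun e e' => g (G.src e) * g (G.src e')) / (G.total * G.wU u) -
        G.pS u (fun e e' => g (G.src e) * g (G.src e') * C e e') / (G.total * G.wU u)) +
      18 * ((∑ e, if G.dst e = u then G.wt e * (g (G.src e) - m) ^ 2 else 0) / G.total) := fun u => by
    have hwU := G.wU_pos u
    have hW := G.total_pos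
    have h := div_le_div_of_nonneg_right (hsum u) (mul_pos hW hwU).le
    rw [G.pS_left, G.pS_right] at h
    refine h.trans (le_of_eq ?_)
    field_simp
    ring
  calc G.defect ℓ = ∑ u, G.pS u (fun e e' => 1 - C e e') / (G.total * G.wU u) := rfl
    _ ≤ ∑ u, (9 * (G.pS u (fun e e' => g (G.src e) * g (G.src e')) / (G.total * G.wU u) -
          G.pS u (fun e e' => g (G.src e) * g (G.src e') * C e e') / (G.total * G.wU u)) +
        18 * ((∑ e, if G.dst e = u then G.wt e * (g (G.src e) - m) ^ 2 else 0) / G.total)) := sum_le_sum fun u _ => hdiv u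
    _ = 9 * (G.symForm g - G.normG (det ℓ g)) + 18 * G.normVE (fun v => g v - m) := by
      rw [sum_add_distrib, ← mul_sum, ← mul_sum, sum_sub_distrib, symForm_eq_pS, normG_det_eq_pS, ← sum_div,
        G.sum_fiber_dst (fun e => G.wt e * (g (G.src e) - m) ^ 2)]
      rfl

/-- The explicit `ε = ε(γ, η)` of the tree's Thm. 3.4: `min (γ/3) (η γ / (18 + 9γ))`. [cite: DinurSteurer2014, Thm. 3.4] -/
noncomputable def dsEps (γ η : ℝ) : ℝ := min (γ / 3) (η * γ / (18 + 9 * γ))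

/-- `0 < dsEps γ η` for `γ, η > 0`. [folklore] -/
theorem dsEps_pos {γ η : ℝ} (hγ : 0 < γ) (hη : 0 < η) : 0 < dsEps γ η :=
  lt_min (by linarith) (div_pos (mul_pos hη hγ) (by linarith))

/-- `dsEps γ η ≤ γ / 3`. [folklore] -/
theorem dsEps_le_left (γ η : ℝ) : dsEps γ η ≤ γ / 3 := min_le_left _ _

/-- `dsEps γ η · (18 + 9γ) ≤ η γ`. [folklore] -/
theorem dsEps_mul_le {γ η : ℝ} (hγ : 0 < γ) : dsEps γ η * (18 + 9 * γ) ≤ η * γ := by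
  have h := min_le_right (γ / 3) (η * γ / (18 + 9 * γ))
  unfold dsEps
  rwa [le_div_iff₀ (by linarith)] at h

/-- `dsEps γ η ≤ 1` when `γ ≤ 1`. [folklore] -/
theorem dsEps_le_one {γ η : ℝ} (hγ1 : γ ≤ 1) : dsEps γ η ≤ 1 := (dsEps_le_left γ η).trans (by linarith)

/-- **Thm. 3.4 for normalised deterministic assignments**: if `G` is `γ`-expanding, `val(G) ≤ 1 - η`,
`g ≥ 0` with `‖g‖² = 1`, then `‖G (det ℓ g)‖² ≤ 1 - ε` for `ε = dsEps γ η`. Printed argument: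
`⟨g, L g⟩ ≤ 1 - ‖G f‖² < ε` and `⟨g, L g⟩ ≥ γ ‖g^⊥‖²` give `𝔼 (g - ḡ)² ≤ ε/γ`, so `ḡ ≥ 2/3`; then the
defect is both `≥ η` and `< 9ε + 18 ε/γ ≤ η`. [cite: DinurSteurer2014, Thm. 3.4] -/
theorem normG_det_le_of_normalised [Nonempty E] {γ η : ℝ} (hγ : 0 < γ) (hη1 : η ≤ 1)
    (hsp : G.Spectral γ) (hval : G.ValLe (1 - η)) (ℓ : V → β) {g : V → ℝ} (hg : ∀ v, 0 ≤ g v)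
    (hnorm : G.normVE g = 1) : G.normG (det ℓ g) ≤ 1 - dsEps γ η := by
  set ε := dsEps γ η with hε
  by_contra hcon
  rw [not_le] at hcon
  have hε3 : ε ≤ γ / 3 := dsEps_le_left γ η
  have hεη : ε * (18 + 9 * γ) ≤ η * γ := dsEps_mul_le hγ
  -- (i) `⟨g, A g⟩ ≥ ‖G f‖² > 1 - ε`, and `⟨g, A g⟩ ≤ ‖g‖² = 1`
  have hdef0 : 0 ≤ G.defect ℓ := by
    unfold defect
    refine sum_nonneg fun u _ => div_nonneg ?_ (mul_pos G.total_pos (G.wU_pos u)).le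
    have h0 : G.pS u (fun _ _ => (0 : ℝ)) = 0 := by rw [G.pS_left u (fun _ => 0)]; simp
    calc (0 : ℝ) = G.pS u (fun _ _ => (0 : ℝ)) := h0.symm
      _ ≤ _ := G.pS_mono u fun e e' _ _ => by split_ifs <;> norm_num
  have hsym_ge : G.normG (det ℓ g) ≤ G.symForm g := by
    -- `symForm - normG det = (defect-type sum with g g') ≥ 0`
    rw [symForm_eq_pS, normG_det_eq_pS]
    refine sum_le_sum fun u _ => div_le_div_of_nonneg_right ?_ (mul_pos G.total_pos (G.wU_pos u)).le
    refine G.pS_mono u fun e e' _ _ => ?_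
    have := mul_nonneg (hg (G.src e)) (hg (G.src e'))
    split_ifs <;> nlinarith
  have hsym_le : G.symForm g ≤ 1 := hnorm ▸ G.symForm_le_normVE g
  -- (ii) variance bound from expansion
  have hvar : G.normVE (fun v => g v - G.meanE g) = 1 - G.meanE g ^ 2 := by rw [normVE_sub_meanE, hnorm]
  have hsp' := hsp g
  rw [hnorm] at hsp'
  have hvar_lt : γ * (1 - G.meanE g ^ 2) < ε := by nlinarith
  have hm0 : 0 ≤ G.meanE g := G.meanE_nonneg hg
  have hm1 : G.meanE g ^ 2 ≤ 1 := by
    have := G.normVE_nonneg (fun v => g v - G.meanE g); rw [hvar] at this; linarith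
  -- (iii) `ḡ ≥ 2/3`
  have hm : 2 / 3 ≤ G.meanE g := by
    by_contra hlt
    rw [not_le] at hlt
    have : G.meanE g ^ 2 < 4 / 9 := by nlinarith
    nlinarith
  -- (iv)-(vi)
  have h1 := G.le_defect hη1 hval ℓ
  have h2 := G.defect_le ℓ hg hm
  rw [hvar] at h2
  have h3 : G.symForm g - G.normG (det ℓ g) < ε := by linarith
  have h4 : 1 - G.meanE g ^ 2 < ε / γ := by rw [lt_div_iff₀ hγ]; linarith
  have h5 : η < 9 * ε + 18 * (ε / γ) := by linarith
  have h6 : (9 * ε + 18 * (ε / γ)) * γ = ε * (18 + 9 * γ) := by field_simp; ring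
  have h7 : η * γ < ε * (18 + 9 * γ) := by rw [← h6]; exact mul_lt_mul_of_pos_right h5 hγ
  linarith

omit [Fintype V] [DecidableEq V] in
/-- `‖G (det ℓ g)‖² ≤ ⟨g, A g⟩` for `g ≥ 0` (dropping the collision indicator). [cite: DinurSteurer2014, Thm. 3.4 (proof)] -/
theorem normG_det_le_symForm [Nonempty E] (ℓ : V → β) {g : V → ℝ} (hg : ∀ v, 0 ≤ g v) :
    G.normG (det ℓ g) ≤ G.symForm g := by
  rw [symForm_eq_pS, normG_det_eq_pS]
  refine sum_le_sum fun u _ => div_le_div_of_nonneg_right ?_ (mul_pos G.total_pos (G.wU_pos u)).le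
  refine G.pS_mono u fun e e' _ _ => ?_
  have := mul_nonneg (hg (G.src e)) (hg (G.src e'))
  split_ifs <;> nlinarith

omit [Fintype V] [Fintype U] [Fintype β] [Fintype α] [DecidableEq V] [DecidableEq U] [DecidableEq β] [DecidableEq α] in
/-- `‖c g‖² = c² ‖g‖²`. [folklore] -/
theorem normVE_smul (c : ℝ) (g : V → ℝ) : G.normVE (c • g) = c ^ 2 * G.normVE g := by
  unfold normVE
  rw [mul_div_assoc', mul_sum]
  congr 1
  refine sum_congr rfl fun e _ => ?_
  simp only [Pi.smul_apply, smul_eq_mul]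
  ring

end PairSums

/-! ### Derandomisation: a best deterministic assignment -/

section Derandomise

/-- The function `h` with the rows in `S` replaced by deterministic rows (labels `ℓ`, same row
sums). [cite: DinurSteurer2014, Thm. 3.4 (proof: "choose a label `β_v` … set `f'(v, β_v) = ∑_β f(v, β)`")] -/
def mix (h : V → β → ℝ) (S : Finset V) (ℓ : V → β) : V → β → ℝ :=
  fun v b => if v ∈ S then (if b = ℓ v then ∑ b', h v b' else 0) else h v b

/-- The function supported on the row `v₀`, with values `y` there. [folklore] -/
def rowAt (v₀ : V) (y : β → ℝ) : V → β → ℝ := fun v b => if v = v₀ then y b else 0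

omit [Fintype V] [Fintype β] [DecidableEq β] in
/-- `rowAt v₀` is additive. [folklore] -/
theorem rowAt_add (v₀ : V) (y y' : β → ℝ) : rowAt v₀ (y + y') = rowAt v₀ y + rowAt v₀ y' := by
  funext v b; simp only [rowAt, Pi.add_apply]; split_ifs <;> ring

omit [Fintype V] [Fintype β] [DecidableEq β] in
/-- `rowAt v₀` is homogeneous. [folklore] -/
theorem rowAt_smul (v₀ : V) (c : ℝ) (y : β → ℝ) : rowAt v₀ (c • y) = c • rowAt v₀ y := by
  funext v b; simp only [rowAt, Pi.smul_apply, smul_eq_mul]; split_ifs <;> ring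

omit [Fintype V] [Fintype β] [DecidableEq β] in
/-- `rowAt v₀` commutes with finite sums. [folklore] -/
theorem rowAt_sum {ι : Type} (v₀ : V) (s : Finset ι) (y : ι → β → ℝ) :
    rowAt v₀ (∑ i ∈ s, y i) = ∑ i ∈ s, rowAt v₀ (y i) := by
  funext v b
  simp only [rowAt, Finset.sum_apply]
  split_ifs <;> simp

omit [Fintype V] in
/-- **Jensen step of the derandomisation**: replacing one row `x ≥ 0` (row sum `s > 0`) of a
function by the vertex `s · e_{β₀}` of the simplex `{y ≥ 0, ∑ y = s}` does not decrease `‖G ·‖²`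
for a suitable `β₀` ("by convexity of the function `f ↦ ‖G f‖` … there must be some `f'` for which
`‖G f'‖ ≥ ‖G f‖`"). [cite: DinurSteurer2014, Thm. 3.4 (proof)] -/
theorem exists_vertex_ge [Nonempty β] (F₀ : V → β → ℝ) (v₀ : V) {x : β → ℝ} (hx : ∀ b, 0 ≤ x b)
    (hs : 0 < ∑ b, x b) :
    ∃ b₀ : β, G.normG (F₀ + rowAt v₀ x) ≤
      G.normG (F₀ + rowAt v₀ ((∑ b, x b) • fun b => if b = b₀ then (1 : ℝ) else 0)) := by
  set s := ∑ b, x b with hs_def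
  set Fb : β → V → β → ℝ := fun b₀ => F₀ + rowAt v₀ (s • fun b => if b = b₀ then (1 : ℝ) else 0) with hFb
  -- the best vertex
  obtain ⟨b₀, -, hb₀⟩ := exists_max_image univ (fun b => G.normG (Fb b)) univ_nonempty
  refine ⟨b₀, ?_⟩
  -- probability weights
  set p : β → ℝ := fun b => x b / s with hp
  have hp0 : ∀ b, 0 ≤ p b := fun b => div_nonneg (hx b) hs.le
  have hp1 : ∑ b, p b = 1 := by rw [hp]; simp only; rw [← sum_div, div_self hs.ne']
  -- `x = ∑_b p_b • (s • e_b)`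
  have hxdec : x = ∑ b, p b • (s • fun b' => if b' = b then (1 : ℝ) else 0) := by
    funext b'
    simp only [Finset.sum_apply, Pi.smul_apply, smul_eq_mul]
    rw [show (∑ c, p c * (s * if b' = c then 1 else 0)) = ∑ c, (if b' = c then p c * s else 0) from
      sum_congr rfl fun c _ => by split_ifs <;> ring]
    rw [sum_ite_eq univ b', if_pos (mem_univ _), hp]
    simp only
    field_simp
  -- `app (F₀ + rowAt x) = ∑_b p_b app (Fb b)`
  have happ : ∀ u a, G.app (F₀ + rowAt v₀ x) u a = ∑ b, p b * G.app (Fb b) u a := fun u a => by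
    have h1 : ∀ b, G.app (Fb b) u a = G.app F₀ u a + G.app (rowAt v₀ (s • fun b' => if b' = b then (1 : ℝ) else 0)) u a :=
      fun b => by rw [hFb]; exact G.app_add _ _ u a
    simp_rw [h1, mul_add]
    rw [sum_add_distrib, ← sum_mul, hp1, one_mul, app_add]
    congr 1
    conv_lhs => rw [hxdec]
    rw [rowAt_sum, app_sum]
    refine sum_congr rfl fun b _ => ?_
    rw [rowAt_smul, app_smul]
  -- Jensen, then the maximum
  calc G.normG (F₀ + rowAt v₀ x) = ∑ u, G.wU u / G.total * ∑ a, (∑ b, p b * G.app (Fb b) u a) ^ 2 := by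
        unfold normG; simp_rw [happ]
    _ ≤ ∑ u, G.wU u / G.total * ∑ a, ∑ b, p b * G.app (Fb b) u a ^ 2 := by
        refine sum_le_sum fun u _ => mul_le_mul_of_nonneg_left (sum_le_sum fun a _ => ?_)
          (div_nonneg (G.wU_pos u).le G.total_nonneg)
        have h := sq_sum_mul_le_mul_sum_mul_sq univ (fun b _ => hp0 b) (fun b => G.app (Fb b) u a)
        rwa [hp1, one_mul] at h
    _ = ∑ b, p b * G.normG (Fb b) := by
        unfold normG
        simp_rw [mul_sum]
        refine Eq.trans (sum_congr rfl fun u _ => sum_comm) ?_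
        rw [sum_comm]
        refine sum_congr rfl fun b _ => sum_congr rfl fun u _ => sum_congr rfl fun a _ => ?_
        ring
    _ ≤ ∑ b, p b * G.normG (Fb b₀) :=
        sum_le_sum fun b _ => mul_le_mul_of_nonneg_left (hb₀ b (mem_univ b)) (hp0 b)
    _ = G.normG (Fb b₀) := by rw [← sum_mul, hp1, one_mul]

/-- **Derandomisation** ("we may assume that `f` is deterministic"): for every nonnegative `h` there
are labels `ℓ` such that the deterministic assignment with the same row sums has `‖G ·‖²` at least
as large. [cite: DinurSteurer2014, Thm. 3.4 (proof) and Lemma 4.1] -/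
theorem exists_det [Nonempty β] {h : V → β → ℝ} (hh : Nonneg h) :
    ∃ ℓ : V → β, G.normG h ≤ G.normG (det ℓ fun v => ∑ b, h v b) := by
  classical
  -- induction over the set of derandomised rows
  have key : ∀ S : Finset V, ∃ ℓ : V → β, G.normG h ≤ G.normG (mix h S ℓ) := by
    intro S
    induction S using Finset.induction_on with
    | empty =>
      exact ⟨fun _ => Classical.arbitrary β,
        le_of_eq (congrArg G.normG (funext fun v => funext fun b => by simp [mix]))⟩
    | insert v₀ S hv₀ ih =>
      obtain ⟨ℓ, hℓ⟩ := ih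
      -- decompose `mix h S ℓ = F₀ + rowAt v₀ (h v₀)`
      set F₀ : V → β → ℝ := fun v b => if v = v₀ then 0 else mix h S ℓ v b with hF₀
      have hdec : mix h S ℓ = F₀ + rowAt v₀ (h v₀) := by
        funext v b
        simp only [hF₀, rowAt, Pi.add_apply]
        by_cases hv : v = v₀
        · subst hv; simp [mix, hv₀]
        · simp [hv]
      have hnext : ∀ b₀ : β, mix h (insert v₀ S) (Function.update ℓ v₀ b₀) =
          F₀ + rowAt v₀ ((∑ b, h v₀ b) • fun b => if b = b₀ then (1 : ℝ) else 0) := fun b₀ => by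
        funext v b
        simp only [hF₀, rowAt, Pi.add_apply, Pi.smul_apply, smul_eq_mul, mix, Finset.mem_insert]
        by_cases hv : v = v₀
        · subst hv
          simp only [true_or, if_true, Function.update_self, zero_add]
          split_ifs <;> ring
        · simp [hv]
      by_cases hs : ∑ b, h v₀ b = 0
      · -- the row is zero: nothing changes
        refine ⟨Function.update ℓ v₀ (Classical.arbitrary β), hℓ.trans (le_of_eq ?_)⟩
        rw [hnext, hdec, hs]
        congr 1
        funext v b
        simp only [Pi.add_apply, rowAt, Pi.smul_apply, smul_eq_mul, zero_mul]
        have hx0 : ∀ b, h v₀ b = 0 := fun b => le_antisymm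
          (by rw [← hs]; exact single_le_sum (f := h v₀) (fun b' _ => hh v₀ b') (mem_univ b)) (hh v₀ b)
        split_ifs <;> simp [hx0]
      · have hs' : 0 < ∑ b, h v₀ b := lt_of_le_of_ne (sum_nonneg fun b _ => hh v₀ b) (Ne.symm hs)
        obtain ⟨b₀, hb₀⟩ := G.exists_vertex_ge F₀ v₀ (hh v₀) hs'
        refine ⟨Function.update ℓ v₀ b₀, hℓ.trans ?_⟩
        rw [hnext, hdec]
        exact hb₀
  obtain ⟨ℓ, hℓ⟩ := key univ
  refine ⟨ℓ, hℓ.trans (le_of_eq ?_)⟩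
  congr 1
  funext v b
  simp [mix, det]

end Derandomise

/-! ### Theorem 3.4 -/

section Thm34

/-- **Dinur–Steurer, Theorem 3.4 (approximation bound for expanding projection games),
contrapositive, supremum-free form.** If `G` is `γ`-expanding (`0 < γ`) and `val(G) ≤ 1 - η`
(`η ≤ 1`), then `‖G h‖² ≤ (1 - ε) · ‖T h‖²` for EVERY nonnegative `h`, with `ε = dsEps γ η > 0`;
i.e. `λ₊(G)² ≤ 1 - ε`. (Printed: "Let `G` be `γ`-expanding. Suppose `λ₊(G) > 1 - ε`. Then
`‖G‖ > 1 - O(ε/γ)`.") Proof: derandomise (`exists_det`), normalise `‖T h‖ = 1` by scaling, and apply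
`normG_det_le_of_normalised`. [cite: DinurSteurer2014, Thm. 3.4] -/
theorem lamLe_of_spectral [Nonempty E] {γ η : ℝ} (hγ : 0 < γ) (hη1 : η ≤ 1) (hsp : G.Spectral γ)
    (hval : G.ValLe (1 - η)) : G.LamLe (1 - dsEps γ η) := by
  classical
  intro h hh
  cases isEmpty_or_nonempty β with
  | inl hβ =>
    have h0 : G.normG h = 0 := by
      unfold normG app lift
      simp
    have h1 : G.normT h = 0 := by
      unfold normT
      simp
    rw [h0, h1, mul_zero]
  | inr hβ =>
    obtain ⟨ℓ, hℓ⟩ := G.exists_det hh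
    have hg : ∀ v, 0 ≤ (fun v => ∑ b, h v b) v := fun v => sum_nonneg fun b _ => hh v b
    have hT : G.normT h = G.normVE (fun v => ∑ b, h v b) := by
      rw [← G.normT_det_eq_normVE ℓ]
      unfold normT
      simp_rw [sum_det]
    rw [hT]
    generalize (fun v => ∑ b, h v b) = g at hℓ hg ⊢
    refine hℓ.trans ?_
    -- scaling
    rcases (G.normVE_nonneg g).eq_or_lt with ht | ht
    · -- `‖g‖ = 0`
      rw [← ht, mul_zero]
      exact (G.normG_det_le_symForm ℓ hg).trans ((G.symForm_le_normVE g).trans (le_of_eq ht.symm))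
    · set t := G.normVE g with ht_def
      set c := (Real.sqrt t)⁻¹ with hc
      have hct : c ^ 2 * t = 1 := by
        rw [hc, inv_pow, Real.sq_sqrt ht.le, inv_mul_cancel₀ ht.ne']
      have hc0 : 0 < c := by rw [hc]; exact inv_pos.2 (Real.sqrt_pos.2 ht)
      have hnorm : G.normVE (c • g) = 1 := by rw [normVE_smul, hct]
      have hcg : ∀ v, 0 ≤ (c • g) v := fun v => by
        simp only [Pi.smul_apply, smul_eq_mul]; exact mul_nonneg hc0.le (hg v)
      have hmain := G.normG_det_le_of_normalised hγ hη1 hsp hval ℓ hcg hnorm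
      rw [det_smul, normG_smul] at hmain
      -- `c² ‖G det‖² ≤ 1 - ε` ⇒ `‖G det‖² ≤ (1 - ε) t`
      have hc2 : 0 < c ^ 2 := by positivity
      calc G.normG (det ℓ g) = (c ^ 2 * G.normG (det ℓ g)) * t := by
            rw [mul_comm (c ^ 2), mul_assoc, hct, mul_one]
        _ ≤ (1 - dsEps γ η) * t := mul_le_mul_of_nonneg_right hmain ht.le

omit [DecidableEq β] in
/-- `LamLe` is monotone in the constant. [folklore] -/
theorem LamLe.mono {G : ProjGame E V U β α} {c c' : ℝ} (h : G.LamLe c) (hc : c ≤ c') : G.LamLe c' :=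
  fun f hf => (h f hf).trans (mul_le_mul_of_nonneg_right hc (G.normT_nonneg f))

end Thm34

end ProjGame

end Literature.Computability.Complexity
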